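import Summits.CriticalPhenomena.CardyFormulaZ2.Theses.CardyUSTContinuation
import Summits.CriticalPhenomena.CardyFormulaZ2.Theorems.CardyUSTContinuationUniformAnalyticExtensionStubRatioToCrux
import Summits.CriticalPhenomena.CardyFormulaZ2.Theorems.CardyUSTContinuationUniformAnalyticExtensionStubSchottky
import Summits.CriticalPhenomena.CardyFormulaZ2.Theorems.CardyUSTContinuationUniformAnalyticExtensionSchottkyReduction
import Summits.CriticalPhenomena.CardyFormulaZ2.Theorems.CardyUSTContinuationUniformAnalyticExtensionStubZeroFreeCrossingOmits
import Literature.Probability.LatticeModels.FKTwoArcPartitionPolynomials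
import HarnessLib

/-!
# Tightness of the Schottky line for the crux `UniformAnalyticExtension`
# (stmt-CriticalPhenomena-6047, route `CardyUSTContinuation`, line `registered`, skeleton v7)

Write `S = [t₁, 1] ⊂ ℂ`, `U_ρ = thickening ρ S`, `Z_δ = fkTwoArcPartitionPolynomials R δ .joint`,
`N_δ = fkTwoArcCrossingPolynomial R δ .joint` (`u_R(t, δ) = N_δ(t)/Z_δ(t)` for `t, δ > 0`).
The crux X_A = `UniformAnalyticExtension` asks for δ-UNIFORM `(ρ, M)` and, eventually in `δ`,
bounded analytic extensions of `u_R(·, δ)|[t₁,1]` to `U_ρ`.  Skeleton v7 of the line (lead c6)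
has ONE physical stub, the value-distribution statement

  (RO)  `∀ R, ∀ t₁ ∈ (0,1), ∃ ρ > 0, ∀ᶠ δ → 0⁺, ∃ h holomorphic on U_ρ, h ≠ 0, h ≠ 1 on U_ρ,`
        `N_δ = h · Z_δ on U_ρ`

("`u_δ` extends to a holomorphic map of a δ-uniform neighbourhood of the segment into
`ℂ ∖ {0, 1}`").  This file proves that the line is TIGHT:

* `tightness_ratioBound_of_ratioOmits` — (RO) ⇒ the normal form of the crux (a δ-uniform bound of
  the junk-valued ratio `N_δ/Z_δ` on `U_{ρ/2}`), by SCHOTTKY's theorem (landed `stub_schottky`,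
  universal constant `C(1, 1/2)`: at each real `t ∈ S` the factor `h` is a probability,
  `h(t) = N_δ(t)/Z_δ(t) ∈ [0,1]`);
* `tightness_crux_of_ratioOmits` — hence (RO) ⇒ X_A (landed normal form `stub_ratioToCrux`);
* `tightness_ratioOmits_of_zeroFree` — the three zero-free stubs of skeleton v6 (`Z_δ ≠ 0`,
  `N_δ ≠ 0`, `N_δ ≠ Z_δ` on a δ-uniform `U_ρ`) ⇒ (RO) with `h = N_δ/Z_δ` (v7 is weaker than v6);
* `tightness_ratioOmits_iff_crux` — given the sibling crux X_S = `SmallFugacityLimit`,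
  (RO) ⇔ X_A: the converse is the landed `zeroFreeCrossing_omits_of_target` (p162728: under
  `Target = X_S ∧ X_A`, Vitali–Porter and the Miller–Werner limit `U(t,η) ∈ (0,1)` force `h_δ` to omit
  `0` and `1` near the segment);
* `tightness_target_iff_ratioOmits` — so the route's `Target` is `X_S ∧ (RO)`.

Reading for the planners: the Schottky cut has no slack — its single remaining stub IS the crux,
restated as a Lee–Yang/Montel statement for the polynomial pencil (`u_δ` misses `0`, `1`, `∞`
δ-uniformly near the critical segment); re-lining inside this idea cannot make it smaller.
-/

noncomputable section

open Filter Topology Set Polynomial Metric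
open Literature.Probability.LatticeModels
open Literature.Probability.RandomPlanarGeometry (ConformalRectangle)

namespace Summit.CriticalPhenomena.CardyFormulaZ2.Cruxes.UniformAnalyticExtension.Birth

open Summit.CriticalPhenomena.CardyFormulaZ2.Theses.CardyUSTContinuation

/-- **(RO) ⇒ normal form, by Schottky.** If, δ-uniformly near `[t₁,1]`, `N_δ = h · Z_δ` with `h`
holomorphic omitting `0` and `1`, then the junk-valued ratio `N_δ/Z_δ` is bounded by the universal
`max (C(1,1/2)) 0` on the `ρ/2`-neighbourhood: about each real `t ∈ [t₁, 1]`, `h` is holomorphic on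
`ball t ρ ⊆ U_ρ`, omits `0`, `1`, and `h(t) = N_δ(t)/Z_δ(t) ∈ [0,1]`; off the zeros of `Z_δ` the
ratio is `h`, at the zeros it is `0`. [folklore] -/
theorem tightness_ratioBound_of_ratioOmits (hO : (∀ R : ConformalRectangle, ∀ t₁ ∈ Set.Ioo (0:ℝ) 1, ∃ ρ > (0:ℝ), ∀ᶠ δ in 𝓝[>] (0:ℝ),
      ∃ h : ℂ → ℂ, DifferentiableOn ℂ h (thickening ρ (((↑) : ℝ → ℂ) '' Set.Icc t₁ 1)) ∧
        (∀ z ∈ thickening ρ (((↑) : ℝ → ℂ) '' Set.Icc t₁ 1), h z ≠ 0 ∧ h z ≠ 1) ∧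
        ∀ z ∈ thickening ρ (((↑) : ℝ → ℂ) '' Set.Icc t₁ 1),
          aeval z (fkTwoArcCrossingPolynomial R δ ArcWiring.joint) =
            h z * aeval z (fkTwoArcPartitionPolynomials R δ ArcWiring.joint))) :
    (∀ R : ConformalRectangle, ∀ t₁ ∈ Set.Ioo (0:ℝ) 1, ∃ ρ > (0:ℝ), ∃ M : ℝ, ∀ᶠ δ in 𝓝[>] (0:ℝ),
      ∀ z ∈ thickening ρ (((↑) : ℝ → ℂ) '' Set.Icc t₁ 1),
        ‖aeval z (fkTwoArcCrossingPolynomial R δ ArcWiring.joint) /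
            aeval z (fkTwoArcPartitionPolynomials R δ ArcWiring.joint)‖ ≤ M) := by
  intro R t₁ ht₁
  obtain ⟨C, hC⟩ := stub_schottky 1 (1 / 2) (by norm_num)
  obtain ⟨ρ, hρ, hev⟩ := hO R t₁ ht₁
  refine ⟨ρ / 2, by positivity, max C 0, ?_⟩
  filter_upwards [hev, self_mem_nhdsWithin] with δ hδ hδpos
  have hδ' : (0:ℝ) < δ := hδpos
  obtain ⟨h, hhd, h01, hNZ⟩ := hδ
  set S : Set ℂ := ((↑) : ℝ → ℂ) '' Set.Icc t₁ 1 with hSdef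
  set N := fkTwoArcCrossingPolynomial R δ ArcWiring.joint with hNdef
  set Z := fkTwoArcPartitionPolynomials R δ ArcWiring.joint with hZdef
  intro z hz
  obtain ⟨_, ⟨t, ht, rfl⟩, hzt⟩ := mem_thickening_iff.1 hz
  have ht0 : 0 < t := ht₁.1.trans_le ht.1
  have hball : ball (t : ℂ) ρ ⊆ thickening ρ S := fun w hw =>
    mem_thickening_iff.2 ⟨t, ⟨t, ht, rfl⟩, mem_ball.1 hw⟩
  have htball : (t : ℂ) ∈ ball (t : ℂ) ρ := mem_ball_self hρ
  by_cases hZz : aeval z Z = 0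
  · rw [hZz, div_zero, norm_zero]
    exact le_max_right _ _
  · have hzball : z ∈ ball (t : ℂ) ρ := mem_ball.2 (by linarith [hzt])
    have hratio : aeval z N / aeval z Z = h z := by
      rw [hNZ z (hball hzball), mul_div_assoc, div_self hZz, mul_one]
    have hZt : aeval (t : ℂ) Z ≠ 0 := by
      rw [hZdef, ← ratioToCrux_ofReal_aeval_natPoly, Complex.ofReal_ne_zero]
      exact (ratioToCrux_aeval_partition_pos R hδ' ht0 _).ne'
    have hht : ‖h t‖ ≤ 1 := by
      have := schottkyReduction_norm_ratio_ofReal_le_one R hδ' ht0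
      rwa [← hNdef, ← hZdef, hNZ _ (hball htball), mul_div_assoc, div_self hZt, mul_one] at this
    rw [hratio]
    exact (hC h t ρ hρ (hhd.mono hball) (fun w hw => (h01 w (hball hw)).1)
      (fun w hw => (h01 w (hball hw)).2) hht z (by linarith [hzt.le])).trans (le_max_left _ _)

/-- **(RO) ⇒ the crux.** The value-distribution statement (RO) implies `UniformAnalyticExtension`
(Schottky for the bound, then the landed normal form `stub_ratioToCrux`: Riemann's removable
singularity theorem and the Literature identity `u_R(t,δ) = N_δ(t)/Z_δ(t)` on the segment).
[folklore] -/
theorem tightness_crux_of_ratioOmits (hO : (∀ R : ConformalRectangle, ∀ t₁ ∈ Set.Ioo (0:ℝ) 1, ∃ ρ > (0:ℝ), ∀ᶠ δ in 𝓝[>] (0:ℝ),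
      ∃ h : ℂ → ℂ, DifferentiableOn ℂ h (thickening ρ (((↑) : ℝ → ℂ) '' Set.Icc t₁ 1)) ∧
        (∀ z ∈ thickening ρ (((↑) : ℝ → ℂ) '' Set.Icc t₁ 1), h z ≠ 0 ∧ h z ≠ 1) ∧
        ∀ z ∈ thickening ρ (((↑) : ℝ → ℂ) '' Set.Icc t₁ 1),
          aeval z (fkTwoArcCrossingPolynomial R δ ArcWiring.joint) =
            h z * aeval z (fkTwoArcPartitionPolynomials R δ ArcWiring.joint))) :
    Summit.CriticalPhenomena.CardyFormulaZ2.Theses.CardyUSTContinuation.UniformAnalyticExtension :=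
  stub_ratioToCrux (tightness_ratioBound_of_ratioOmits hO)

/-- **v6 ⇒ v7.** The three δ-uniform zero-free statements of skeleton v6 (`Z_δ ≠ 0`, `N_δ ≠ 0`,
`N_δ ≠ Z_δ` on a δ-uniform neighbourhood of `[t₁,1]`, bodies verbatim) give (RO) with
`h = N_δ/Z_δ`. [folklore] -/
theorem tightness_ratioOmits_of_zeroFree
    (hZ : ∀ R : ConformalRectangle, ∀ t₁ ∈ Set.Ioo (0:ℝ) 1, ∃ ρ > (0:ℝ), ∀ᶠ δ in 𝓝[>] (0:ℝ),
      ∀ z ∈ thickening ρ (((↑) : ℝ → ℂ) '' Set.Icc t₁ 1),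
        aeval z (fkTwoArcPartitionPolynomials R δ ArcWiring.joint) ≠ 0)
    (hN : ∀ R : ConformalRectangle, ∀ t₁ ∈ Set.Ioo (0:ℝ) 1, ∃ ρ > (0:ℝ), ∀ᶠ δ in 𝓝[>] (0:ℝ),
      ∀ z ∈ thickening ρ (((↑) : ℝ → ℂ) '' Set.Icc t₁ 1),
        aeval z (fkTwoArcCrossingPolynomial R δ ArcWiring.joint) ≠ 0)
    (hNc : ∀ R : ConformalRectangle, ∀ t₁ ∈ Set.Ioo (0:ℝ) 1, ∃ ρ > (0:ℝ), ∀ᶠ δ in 𝓝[>] (0:ℝ),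
      ∀ z ∈ thickening ρ (((↑) : ℝ → ℂ) '' Set.Icc t₁ 1),
        aeval z (fkTwoArcCrossingPolynomial R δ ArcWiring.joint) ≠
          aeval z (fkTwoArcPartitionPolynomials R δ ArcWiring.joint)) :
    (∀ R : ConformalRectangle, ∀ t₁ ∈ Set.Ioo (0:ℝ) 1, ∃ ρ > (0:ℝ), ∀ᶠ δ in 𝓝[>] (0:ℝ),
      ∃ h : ℂ → ℂ, DifferentiableOn ℂ h (thickening ρ (((↑) : ℝ → ℂ) '' Set.Icc t₁ 1)) ∧
        (∀ z ∈ thickening ρ (((↑) : ℝ → ℂ) '' Set.Icc t₁ 1), h z ≠ 0 ∧ h z ≠ 1) ∧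
        ∀ z ∈ thickening ρ (((↑) : ℝ → ℂ) '' Set.Icc t₁ 1),
          aeval z (fkTwoArcCrossingPolynomial R δ ArcWiring.joint) =
            h z * aeval z (fkTwoArcPartitionPolynomials R δ ArcWiring.joint)) := by
  intro R t₁ ht₁
  obtain ⟨ρ₁, hρ₁, h₁⟩ := hZ R t₁ ht₁
  obtain ⟨ρ₂, hρ₂, h₂⟩ := hN R t₁ ht₁
  obtain ⟨ρ₃, hρ₃, h₃⟩ := hNc R t₁ ht₁
  set ρ := min ρ₁ (min ρ₂ ρ₃) with hρdef
  refine ⟨ρ, lt_min hρ₁ (lt_min hρ₂ hρ₃), ?_⟩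
  filter_upwards [h₁, h₂, h₃] with δ h₁δ h₂δ h₃δ
  set S : Set ℂ := ((↑) : ℝ → ℂ) '' Set.Icc t₁ 1 with hSdef
  set N := fkTwoArcCrossingPolynomial R δ ArcWiring.joint with hNdef
  set Z := fkTwoArcPartitionPolynomials R δ ArcWiring.joint with hZdef
  have hT₁ : thickening ρ S ⊆ thickening ρ₁ S := thickening_mono (min_le_left _ _) S
  have hT₂ : thickening ρ S ⊆ thickening ρ₂ S :=
    thickening_mono ((min_le_right _ _).trans (min_le_left _ _)) S
  have hT₃ : thickening ρ S ⊆ thickening ρ₃ S :=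
    thickening_mono ((min_le_right _ _).trans (min_le_right _ _)) S
  refine ⟨fun w => aeval w N / aeval w Z, fun w hw =>
    (((Polynomial.differentiable_aeval N) w).div ((Polynomial.differentiable_aeval Z) w)
      (h₁δ w (hT₁ hw))).differentiableWithinAt, fun w hw => ⟨?_, ?_⟩, fun w hw => ?_⟩
  · exact div_ne_zero (h₂δ w (hT₂ hw)) (h₁δ w (hT₁ hw))
  · intro h
    exact h₃δ w (hT₃ hw) ((div_eq_one_iff_eq (h₁δ w (hT₁ hw))).1 h)
  · rw [div_mul_cancel₀ _ (h₁δ w (hT₁ hw))]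

/-- **Tightness of the Schottky line.** Given the sibling crux `SmallFugacityLimit` (X_S), the one
physical stub (RO) of skeleton v7 is EQUIVALENT to the crux `UniformAnalyticExtension` (X_A):
(RO) ⇒ X_A by Schottky; X_A ⇒ (RO) because `X_S ∧ X_A` is the route's `Target` and `Target ⇒ (RO)`
(`zeroFreeCrossing_omits_of_target`: Vitali–Porter + the Miller–Werner limit takes values in `(0,1)`
on the segment). [folklore] -/
theorem tightness_ratioOmits_iff_crux : Summit.CriticalPhenomena.CardyFormulaZ2.Theses.CardyUSTContinuation.SmallFugacityLimit → ((∀ R : ConformalRectangle, ∀ t₁ ∈ Set.Ioo (0:ℝ) 1, ∃ ρ > (0:ℝ), ∀ᶠ δ in 𝓝[>] (0:ℝ), ∃ h : ℂ → ℂ, DifferentiableOn ℂ h (thickening ρ (((↑) : ℝ → ℂ) '' Set.Icc t₁ 1)) ∧ (∀ z ∈ thickening ρ (((↑) : ℝ → ℂ) '' Set.Icc t₁ 1), h z ≠ 0 ∧ h z ≠ 1) ∧ ∀ z ∈ thickening ρ (((↑) : ℝ → ℂ) '' Set.Icc t₁ 1), aeval z (fkTwoArcCrossingPolynomial R δ ArcWiring.joint)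 = h z * aeval z (fkTwoArcPartitionPolynomials R δ ArcWiring.joint)) ↔ Summit.CriticalPhenomena.CardyFormulaZ2.Theses.CardyUSTContinuation.UniformAnalyticExtension) :=
  fun hS => ⟨fun hO => tightness_crux_of_ratioOmits hO,
    fun hA => zeroFreeCrossing_omits_of_target ⟨hS, hA⟩⟩

/-- **The route thesis in value-distribution form.** `Target` (= X_S ∧ X_A) is equivalent to
X_S together with (RO): δ-uniformly near every `[t₁, 1]`, the crossing ratio `N_δ/Z_δ` is a
holomorphic map into `ℂ ∖ {0, 1}`. [folklore] -/
theorem tightness_target_iff_ratioOmits :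
    Summit.CriticalPhenomena.CardyFormulaZ2.Theses.CardyUSTContinuation.Target ↔
      Summit.CriticalPhenomena.CardyFormulaZ2.Theses.CardyUSTContinuation.SmallFugacityLimit ∧
        (∀ R : ConformalRectangle, ∀ t₁ ∈ Set.Ioo (0:ℝ) 1, ∃ ρ > (0:ℝ), ∀ᶠ δ in 𝓝[>] (0:ℝ),
      ∃ h : ℂ → ℂ, DifferentiableOn ℂ h (thickening ρ (((↑) : ℝ → ℂ) '' Set.Icc t₁ 1)) ∧
        (∀ z ∈ thickening ρ (((↑) : ℝ → ℂ) '' Set.Icc t₁ 1), h z ≠ 0 ∧ h z ≠ 1) ∧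
        ∀ z ∈ thickening ρ (((↑) : ℝ → ℂ) '' Set.Icc t₁ 1),
          aeval z (fkTwoArcCrossingPolynomial R δ ArcWiring.joint) =
            h z * aeval z (fkTwoArcPartitionPolynomials R δ ArcWiring.joint)) :=
  ⟨fun hT => ⟨hT.1, zeroFreeCrossing_omits_of_target hT⟩,
    fun h => ⟨h.1, tightness_crux_of_ratioOmits h.2⟩⟩

end Summit.CriticalPhenomena.CardyFormulaZ2.Cruxes.UniformAnalyticExtension.Birth
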